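import Summits.AtomisticToContinuum.HydrodynamicLimit.Theorems.CollisionIsometryCLTAprioriBoundsVisitLedgerDefs
import HarnessLib

/-!
# `AprioriBounds` (stmt-AtomisticToContinuum-9519), line `visit-ledger-upscattering`: initial visits are free

Registered stub `stub_initialMoment` (B1 of the lead's skeleton
`Cruxes/AprioriBounds/Lines/visit_ledger_upscattering.lean`; `--supports` the crux): for nice
profiles `(a₀, θ₀, u₀)` (continuous, `a₀, θ₀ > 0`), `0 < σ ≤ 1/2` and ANY family of flows `Φ`,
there is a rate `λ₀ > 0` such that for every `0 < λ ≤ λ₀` some deterministic level `C₀` bounds the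
time-zero empirical exponential velocity moment `(N+1)⁻¹ Σᵢ e^{λ|vᵢ|²}` with local Gibbs
probability `→ 1` (`InitAt σ a₀ θ₀ u₀ Φ λ C₀` of the line's vocabulary
`Theorems/CollisionIsometryCLTAprioriBoundsVisitLedgerDefs.lean`).

## Proof

The local Gibbs law does not depend on the flow (`localGibbsLaw_eq`) and, given the positions,
the velocities are independent Gaussians `vᵢ = u₀(xᵢ) + √θ₀(xᵢ) gᵢ`, `gᵢ ∼ N(0, I₃)` i.i.d.
(`localGibbsMeasure_velFluct_le`, the conditional Bienaymé–Chebyshev bound of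
`HardSphereEulerProofs`). With `U = sup ‖u₀‖`, `Θ ≥ sup θ₀` (compact torus) and
`|u + w|² ≤ 2|u|² + 2|w|²`, the weight is dominated by an `x`-INDEPENDENT functional of the
standard Gaussian: `e^{λ|vᵢ|²} ≤ F(gᵢ) := e^{2λU²} e^{2λΘ|gᵢ|²}`. By Fernique's theorem
(`IsGaussian.exists_integrable_exp_sq`) `e^{C|g|²}` is integrable under `N(0, I₃)` for some
`C > 0`; for `λ ≤ λ₀ := C/(4Θ)` both `F` and `F²` are dominated by multiples of `e^{C|g|²}`, so
`Y(x, v) := F((v - u₀ x)/√θ₀ x) - m`, `m := E F(g)`, is centred with variance `≤ B := E (F(g) - m)²`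
under `N(u₀(x), θ₀(x) I₃)` for EVERY `x` (transfer along the affine map, `integral_gaussMeasure`).
On `{m + 1 < (N+1)⁻¹Σᵢ e^{λ|vᵢ|²}}` we have `1 < (N+1)⁻¹ Σᵢ Y(xᵢ, vᵢ)`, an event of probability
`≤ B/(N+1) → 0`. So `C₀ := m + 1` works.
-/

noncomputable section

open MeasureTheory ProbabilityTheory Filter Set Topology
open scoped ENNReal BigOperators

namespace Summit.AtomisticToContinuum.HydrodynamicLimit.Theorems.VisitLedgerUpscattering

open Literature.MathematicalPhysics.KineticTheory Literature.Analysis.FluidPDE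

/-! ## The probabilistic core: Chebyshev given the positions for a dominated weight -/

/-- **Chebyshev step.** If a jointly measurable per-particle observable `Y(x, v)` is, along the
affine Gaussian parametrisation `v = u₀ x + √θ₀ x • w`, an `x`-independent square-integrable
functional `F(w) - m` of the standard Gaussian (`m = E F`), and dominates the weight,
`e^{λ|v|²} ≤ Y(x, v) + m`, then the time-zero empirical exponential moment at rate `λ` exceeds
`m + 1` with local Gibbs probability `≤ B/(N+1) → 0` (`B = E (F - m)²`), for every family of
flows. -/
private theorem initAt_of_dominated {a₀ θ₀ : T3 → ℝ} {u₀ : T3 → V3} (ha : Continuous a₀)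
    (hθ : Continuous θ₀) (hu : Continuous u₀) (ha0 : ∀ x, 0 < a₀ x) (hθ0 : ∀ x, 0 < θ₀ x)
    {σ : ℝ} (hσ2 : σ ≤ 1 / 2) (Φ : Flows σ) {lam : ℝ} {F : V3 → ℝ} (hFm : Measurable F)
    (hFint : Integrable F (stdGaussian V3))
    (hF2int : Integrable (fun w => F w ^ 2) (stdGaussian V3)) {Y : T3 → V3 → ℝ}
    (hYm : Measurable fun p : T3 × V3 => Y p.1 p.2)
    (hYs : ∀ x (w : V3), Y x (u₀ x + Real.sqrt (θ₀ x) • w) = F w - ∫ w, F w ∂stdGaussian V3)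
    (hptw : ∀ x (v : V3), Real.exp (lam * ‖v‖ ^ 2) ≤ Y x v + ∫ w, F w ∂stdGaussian V3) :
    InitAt σ a₀ θ₀ u₀ Φ lam ((∫ w, F w ∂stdGaussian V3) + 1) := by
  set m : ℝ := ∫ w, F w ∂stdGaussian V3 with hm
  set B : ℝ := ∫ w, (F w - m) ^ 2 ∂stdGaussian V3 with hB
  have hFm2 : MemLp (fun w => F w - m) 2 (stdGaussian V3) :=
    ((memLp_two_iff_integrable_sq hFm.aestronglyMeasurable).2 hF2int).sub (memLp_const m)
  have hYxm : ∀ x, Measurable (Y x) := fun x => hYm.comp (measurable_const.prodMk measurable_id)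
  have hshift : ∀ x, Measurable (fun w : V3 => u₀ x + Real.sqrt (θ₀ x) • w) :=
    fun x => measurable_gaussShift (u₀ x) (θ₀ x)
  -- the observable is square integrable, centred, of variance `≤ B`, uniformly in `x`
  have hY2 : ∀ x, MemLp (Y x) 2 (gaussMeasure (u₀ x) (θ₀ x)) := by
    intro x
    rw [gaussMeasure, memLp_map_measure_iff (hYxm x).aestronglyMeasurable (hshift x).aemeasurable]
    have hcomp : Y x ∘ (fun w : V3 => u₀ x + Real.sqrt (θ₀ x) • w) = fun w => F w - m :=
      funext fun w => hYs x w
    rw [hcomp]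
    exact hFm2
  have hY0 : ∀ x, ∫ v, Y x v ∂gaussMeasure (u₀ x) (θ₀ x) = 0 := by
    intro x
    rw [integral_gaussMeasure (u₀ x) (hθ0 x)]
    simp_rw [hYs]
    rw [integral_sub hFint (integrable_const m), integral_const]
    simp [hm]
  have hYB : ∀ x, Var[Y x; gaussMeasure (u₀ x) (θ₀ x)] ≤ B := by
    intro x
    refine (variance_le_expectation_sq (hYxm x).aestronglyMeasurable).trans (le_of_eq ?_)
    show ∫ v, (Y x v) ^ 2 ∂gaussMeasure (u₀ x) (θ₀ x) = B
    rw [integral_gaussMeasure (u₀ x) (hθ0 x)]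
    simp_rw [hYs]
    exact hB.symm
  -- Chebyshev given the positions, for every `N`
  have hcheb : ∀ N : ℕ, localGibbsLaw σ a₀ u₀ θ₀ N (Φ N)
      {z | m + 1 < ∫ y, Real.exp (lam * ‖y.2‖ ^ 2) ∂(empiricalMeasure z)} ≤
      ENNReal.ofReal ((1 : ℝ) ^ 2 * B / ((N + 1 : ℕ) * (1 : ℝ) ^ 2)) := by
    intro N
    haveI := isProbabilityMeasure_localGibbsMeasure ha hθ hu ha0 hθ0 hσ2 N
    have h := localGibbsMeasure_velFluct_le ha hθ hu (fun x => (ha0 x).le) hθ0 σ N hYm hY2 hY0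
      hYB (χ := fun _ => (1 : ℝ)) continuous_const (C := 1) (fun _ => by simp) (δ := 1) one_pos
    rw [localGibbsLaw_eq]
    refine le_trans (measure_mono fun z hz => ?_) h
    simp only [mem_setOf_eq, integral_empiricalMeasure] at hz
    simp only [mem_setOf_eq, one_mul]
    have havg : ((N + 1 : ℕ) : ℝ)⁻¹ * ∑ i, Y (z i).1 (z i).2 + m =
        ((N + 1 : ℕ) : ℝ)⁻¹ * ∑ i, (Y (z i).1 (z i).2 + m) := by
      rw [Finset.sum_add_distrib, Finset.sum_const, Finset.card_univ, Fintype.card_fin,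
        nsmul_eq_mul, mul_add, ← mul_assoc, inv_mul_cancel₀ (by positivity), one_mul]
    have hsum : ((N + 1 : ℕ) : ℝ)⁻¹ * ∑ i, Real.exp (lam * ‖(z i).2‖ ^ 2) ≤
        ((N + 1 : ℕ) : ℝ)⁻¹ * ∑ i, Y (z i).1 (z i).2 + m := by
      rw [havg]
      exact mul_le_mul_of_nonneg_left (Finset.sum_le_sum fun i _ => hptw (z i).1 (z i).2)
        (by positivity)
    rw [le_abs]
    left
    linarith
  unfold InitAt
  exact tendsto_of_tendsto_of_tendsto_of_le_of_le tendsto_const_nhds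
    (tendsto_ofReal_div_succ_mul ((1 : ℝ) ^ 2 * B) ((1 : ℝ) ^ 2)) (fun _ => zero_le) hcheb

/-! ## The registered stub -/

/-- **Initial visits are free** (B1 of the line `visit-ledger-upscattering`): for nice profiles,
`0 < σ ≤ 1/2` and every family of flows `Φ` there is `λ₀ > 0` such that for every rate
`0 < λ ≤ λ₀` the time-zero empirical exponential moment `(N+1)⁻¹ Σᵢ e^{λ|vᵢ|²}` is bounded by a
deterministic `C₀` with local Gibbs probability `→ 1`. Fernique's theorem for the standard
Gaussian on `ℝ³` and Bienaymé–Chebyshev given the positions (`initAt_of_dominated`). -/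
theorem stub_initialMoment :
    ∀ (a₀ θ₀ : T3 → ℝ) (u₀ : T3 → V3), NiceProfiles a₀ θ₀ u₀ →
      ∀ σ : ℝ, 0 < σ → σ ≤ 1 / 2 → ∀ Φ : Flows σ,
        ∃ lam₀ : ℝ, 0 < lam₀ ∧ ∀ lam : ℝ, 0 < lam → lam ≤ lam₀ →
          ∃ C₀ : ℝ, InitAt σ a₀ θ₀ u₀ Φ lam C₀ := by
  intro a₀ θ₀ u₀ hP σ _hσ hσ2 Φ
  obtain ⟨ha, hθ, hu, ha0, hθ0⟩ := hP
  -- Fernique: a Gaussian moment of the standard Gaussian on `ℝ³` is finite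
  obtain ⟨C, hC, hCint⟩ := IsGaussian.exists_integrable_exp_sq (stdGaussian V3)
  -- bounds on the (continuous) temperature and velocity profiles on the compact torus
  obtain ⟨Θ, hΘ0, hΘ⟩ := exists_forall_abs_le_of_continuous hθ
  obtain ⟨U, _hU0, hU⟩ := exists_forall_abs_le_of_continuous (continuous_norm.comp hu)
  have hθΘ : ∀ x, θ₀ x ≤ Θ + 1 := fun x => ((le_abs_self _).trans (hΘ x)).trans (by linarith)
  have huU : ∀ x, ‖u₀ x‖ ≤ U := fun x => (le_abs_self _).trans (hU x)
  have hΘ1 : 0 < Θ + 1 := by linarith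
  refine ⟨C / (4 * (Θ + 1)), by positivity, fun lam hlam hlamle => ?_⟩
  -- the rate `c = 2λ(Θ+1)` of the dominating functional; `2c ≤ C`
  have h2c : 2 * (2 * lam * (Θ + 1)) ≤ C := by
    have := (le_div_iff₀ (by positivity : (0 : ℝ) < 4 * (Θ + 1))).1 hlamle
    linarith
  -- Gaussian moments of rate `≤ C` are finite
  have hdom : ∀ {a : ℝ}, a ≤ C →
      Integrable (fun w : V3 => Real.exp (a * ‖w‖ ^ 2)) (stdGaussian V3) := by
    intro a haC
    refine hCint.mono'
      (by fun_prop : Measurable fun w : V3 => Real.exp (a * ‖w‖ ^ 2)).aestronglyMeasurable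
      (Eventually.of_forall fun w => ?_)
    rw [Real.norm_eq_abs, abs_of_pos (Real.exp_pos _)]
    exact Real.exp_le_exp.2 (mul_le_mul_of_nonneg_right haC (sq_nonneg _))
  -- the dominating functional `F(w) = e^{2λU²} e^{c|w|²}` and the observable `Y`
  refine ⟨_, initAt_of_dominated ha hθ hu ha0 hθ0 hσ2 Φ
    (F := fun w => Real.exp (2 * lam * U ^ 2) * Real.exp (2 * lam * (Θ + 1) * ‖w‖ ^ 2))
    (Y := fun x v => Real.exp (2 * lam * U ^ 2) *
      Real.exp (2 * lam * (Θ + 1) * (‖v - u₀ x‖ ^ 2 / θ₀ x)) -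
        ∫ w, Real.exp (2 * lam * U ^ 2) * Real.exp (2 * lam * (Θ + 1) * ‖w‖ ^ 2)
          ∂stdGaussian V3)
    (by fun_prop) ((hdom (by nlinarith)).const_mul _) ?_ ?_ (fun x w => ?_) (fun x v => ?_)⟩
  · -- `F²` is integrable
    refine ((hdom h2c).const_mul (Real.exp (2 * lam * U ^ 2) ^ 2)).congr
      (Eventually.of_forall fun w => ?_)
    simp only
    rw [mul_pow, sq (Real.exp (2 * lam * (Θ + 1) * ‖w‖ ^ 2)), ← Real.exp_add]
    congr 2
    ring
  · -- joint measurability of `Y`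
    have hum : Measurable u₀ := hu.measurable
    have hθm : Measurable θ₀ := hθ.measurable
    fun_prop
  · -- along the affine parametrisation `Y` is `F - m`
    simp only
    rw [add_sub_cancel_left, norm_smul, Real.norm_eq_abs, abs_of_nonneg (Real.sqrt_nonneg _),
      mul_pow, Real.sq_sqrt (hθ0 x).le, mul_div_cancel_left₀ _ (hθ0 x).ne']
  · -- pointwise domination `e^{λ|v|²} ≤ F((v - u₀ x)/√θ₀ x) = Y x v + m`
    simp only [sub_add_cancel]
    rw [← Real.exp_add]
    refine Real.exp_le_exp.2 ?_
    have h1 : ‖v‖ ≤ ‖u₀ x‖ + ‖v - u₀ x‖ := norm_le_norm_add_norm_sub' v (u₀ x)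
    have h2 : ‖v‖ ^ 2 ≤ 2 * ‖u₀ x‖ ^ 2 + 2 * ‖v - u₀ x‖ ^ 2 := by
      have h := pow_le_pow_left₀ (norm_nonneg _) h1 2
      nlinarith [h, sq_nonneg (‖u₀ x‖ - ‖v - u₀ x‖)]
    have h3 : θ₀ x * (‖v - u₀ x‖ ^ 2 / θ₀ x) = ‖v - u₀ x‖ ^ 2 := by
      rw [← mul_div_assoc, mul_div_cancel_left₀ _ (hθ0 x).ne']
    have h4 : θ₀ x * (‖v - u₀ x‖ ^ 2 / θ₀ x) ≤ (Θ + 1) * (‖v - u₀ x‖ ^ 2 / θ₀ x) :=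
      mul_le_mul_of_nonneg_right (hθΘ x) (div_nonneg (sq_nonneg _) (hθ0 x).le)
    have h5 : ‖u₀ x‖ ^ 2 ≤ U ^ 2 := pow_le_pow_left₀ (norm_nonneg _) (huU x) 2
    nlinarith

end Summit.AtomisticToContinuum.HydrodynamicLimit.Theorems.VisitLedgerUpscattering

end
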